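import Literature.Geometry.Kaehler.GrauertOkaPrinciple
import Literature.Analysis.Complex.HolomorphicCocyclesAffine
import Mathlib.Analysis.Matrix.Normed
import Mathlib.Geometry.Manifold.MFDeriv.FDeriv
import HarnessLib

/-!
# Grauert's Oka principle over `ℂⁿ` in all ranks: holomorphic vector bundles over a complex vector space are analytically trivial (Grauert 1958; Leiterer, SCV IV, Ch. II, Cor. 2.17 / 3.3–3.4)

The named fact `Literature.Geometry.Kaehler.grauert_oka_analyticallyEquivalent`
(Fritzsche–Grauert, GTM 213, Ch. V §1.5 (2): over a Stein manifold, topologically equivalent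
holomorphic vector bundles are analytically equivalent) is Grauert's theorem (Math. Ann. 135
(1958)); over an abstract Stein base its proof needs Cartan's Theorem B. This file PROVES the case
in which the base is the model vector space itself — `M = E`, any finite-dimensional complex normed
space charted on itself, ANY rank `r`, arbitrary covers — from the tree's theorem that holomorphic
`GL_r(ℂ)`-cocycles on `ℂ^ι` are holomorphically trivial
(`Literature.Analysis.Complex.HolCocycle.exists_frame_univ`, Leiterer's proof of Grauert's
theorem for `X = ℂⁿ`: Cartan's lemma on holomorphic matrices, the cube induction and the
exhaustion; files `RungeBoxes`, `CartanSplitting`, `HolomorphicCocyclesAffine`):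

* `SmoothComplexVectorBundle.IsHolomorphic.analyticallyEquivalent_trivial_pi`: every holomorphic
  cocycle of rank `r` on `ℂ^ι` is analytically equivalent to the trivial bundle (Leiterer, SCV IV,
  Ch. II, Cor. 2.17: "every holomorphic vector bundle over `D` [a starlike domain of holomorphy]
  is holomorphically trivial"; Cor. 3.4 for contractible Stein spaces);
* `SmoothComplexVectorBundle.analyticallyEquivalent_of_isHolomorphic_pi` / `_self`: hence any two
  holomorphic cocycles of the same rank on `ℂ^ι`, resp. on a finite-dimensional `E` (transport
  along a complex-linear `E ≃ ℂ^{dim E}`), are analytically equivalent;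
* `grauert_oka_analyticallyEquivalent_self`: **the case `M = E` of the named fact, all ranks, in
  the fact's binder shape** (the topological-equivalence hypothesis is not even needed there,
  both bundles being analytically trivial; the fact's remaining hypotheses — `T2Space`,
  `SecondCountableTopology`, `IsManifold 𝓘(ℂ, E) ω E`, `IsSteinManifold E E` — hold for `E`
  and are not used).

The bridge between the bundle language (entrywise `MDifferentiableOn 𝓘(ℂ, E) 𝓘(ℂ, ℂ)` of
matrix-valued maps) and the analytic files (maps into the Banach algebra
`Matrix (Fin r) (Fin r) ℂ` with Mathlib's `L^∞`-operator norm, `Matrix.Norms.Operator`) is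
`differentiableOn_matrix_iff_entry`. The transport of cocycles and isomorphisms along a
complex-linear equivalence of the base (`SmoothComplexVectorBundle.transport`,
`CocycleIso.transport/ofTransport`) is the elementary change of the base variable.

What is NOT here: an abstract Stein base (needs Theorem B / an embedding theorem), i.e. the
named fact itself stays a named fact; this file discharges its `M = E` slice.

## References

* J. Leiterer, *Holomorphic vector bundles and the Oka–Grauert principle*, in: Several Complex
  Variables IV, Encyclopaedia Math. Sci. 10 (1990), Ch. II, Cor. 2.17, Thm. 3.2, Cor. 3.3 (i),
  Cor. 3.4 [LeitererSCV4].
* K. Fritzsche, H. Grauert, *From Holomorphic Functions to Complex Manifolds*, GTM 213 (2002),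
  Ch. V §1.5 (Oka's principle) (2) [FritzscheGrauert2002].
* H. Grauert, *Analytische Faserungen über holomorph-vollständigen Räumen*, Math. Ann. 135 (1958)
  263–273.
-/

noncomputable section

open scoped Manifold ContDiff Topology Matrix Matrix.Norms.Operator
open Set

namespace Literature.Geometry.Kaehler

/-! ### Matrix-valued maps: entrywise versus normed differentiability -/

section MatrixBridge

variable {r : ℕ} {X : Type*} [NormedAddCommGroup X] [NormedSpace ℂ X]

/-- A matrix-valued map is complex-differentiable (for the `L^∞`-operator norm on matrices, or
any norm) iff all its entries are. [folklore] -/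
theorem differentiableOn_matrix_iff_entry {f : X → Matrix (Fin r) (Fin r) ℂ} {s : Set X} :
    DifferentiableOn ℂ f s ↔ ∀ p q, DifferentiableOn ℂ (fun x ↦ f x p q) s := by
  constructor
  · intro h p q
    have hc : Continuous (Matrix.entryLinearMap ℂ ℂ p q : Matrix (Fin r) (Fin r) ℂ →ₗ[ℂ] ℂ) :=
      LinearMap.continuous_of_finiteDimensional _
    set L : Matrix (Fin r) (Fin r) ℂ →L[ℂ] ℂ := ⟨Matrix.entryLinearMap ℂ ℂ p q, hc⟩ with hL
    have e : (fun x ↦ f x p q) = L ∘ f := by funext x; simp [hL]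
    rw [e]
    exact L.differentiable.comp_differentiableOn h
  · intro h
    have e : f = fun x ↦ ∑ p, ∑ q, (f x p q) • Matrix.single p q (1 : ℂ) := by
      funext x
      conv_lhs => rw [Matrix.matrix_eq_sum_single (f x)]
      refine Finset.sum_congr rfl fun p _ ↦ Finset.sum_congr rfl fun q _ ↦ ?_
      rw [Matrix.smul_single, smul_eq_mul, mul_one]
    rw [e]
    exact DifferentiableOn.fun_sum fun p _ ↦ DifferentiableOn.fun_sum fun q _ ↦
      (h p q).smul_const _

end MatrixBridge

/-! ### Transport along a complex-linear equivalence of the base vector space -/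

section Transport

variable {ι ι' : Type*} {E E' : Type*} [NormedAddCommGroup E] [NormedSpace ℂ E]
  [NormedAddCommGroup E'] [NormedSpace ℂ E'] {r : ℕ}

namespace SmoothComplexVectorBundle

/-- **Transport of a cocycle** on the complex vector space `E` (as a manifold charted on itself)
along a continuous complex-linear equivalence `Φ : E ≃ E'`: base sets `Φ(U_i)`, transition
matrices `g_{ij} ∘ Φ⁻¹` (a linear change of the base variable). [folklore] -/
def transport (V : SmoothComplexVectorBundle ι E E r) (Φ : E ≃L[ℂ] E') :
    SmoothComplexVectorBundle ι E' E' r where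
  baseSet i := Φ.symm ⁻¹' V.baseSet i
  isOpen_baseSet i := (V.isOpen_baseSet i).preimage Φ.symm.continuous
  exists_mem_baseSet y := V.exists_mem_baseSet (Φ.symm y)
  coordChange i j y := V.coordChange i j (Φ.symm y)
  contMDiffOn_coordChange i j a b := by
    have h := contMDiffOn_iff_contDiffOn.1 (V.contMDiffOn_coordChange i j a b)
    exact contMDiffOn_iff_contDiffOn.2
      (h.comp (Φ.symm.contDiff.restrict_scalars ℝ).contDiffOn fun _ hy ↦ hy)
  coordChange_self i y hy := V.coordChange_self i (Φ.symm y) hy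
  coordChange_comp i j k y hy := V.coordChange_comp i j k (Φ.symm y) hy

/-- Base sets of the transported cocycle (definitional). [folklore] -/
@[simp]
theorem transport_baseSet (V : SmoothComplexVectorBundle ι E E r) (Φ : E ≃L[ℂ] E') (i : ι) :
    (V.transport Φ).baseSet i = Φ.symm ⁻¹' V.baseSet i :=
  rfl

/-- Transition matrices of the transported cocycle (definitional). [folklore] -/
@[simp]
theorem transport_coordChange (V : SmoothComplexVectorBundle ι E E r) (Φ : E ≃L[ℂ] E') (i j : ι)
    (y : E') : (V.transport Φ).coordChange i j y = V.coordChange i j (Φ.symm y) :=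
  rfl

/-- Transport preserves holomorphy of the cocycle. [folklore] -/
theorem IsHolomorphic.transport {V : SmoothComplexVectorBundle ι E E r} (hV : V.IsHolomorphic)
    (Φ : E ≃L[ℂ] E') : (V.transport Φ).IsHolomorphic := fun i j a b ↦ by
  have h := mdifferentiableOn_iff_differentiableOn.1 (hV i j a b)
  exact mdifferentiableOn_iff_differentiableOn.2 (h.comp Φ.symm.differentiableOn fun _ hy ↦ hy)

namespace CocycleIso

variable {V₁ : SmoothComplexVectorBundle ι E E r} {V₂ : SmoothComplexVectorBundle ι' E E r}

/-- An isomorphism of the transported cocycles, read back on `E` (`λ_{a i} ∘ Φ`). [folklore] -/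
def ofTransport {Φ : E ≃L[ℂ] E'} (Ψ : CocycleIso (V₁.transport Φ) (V₂.transport Φ)) :
    CocycleIso V₁ V₂ where
  map a i x := Ψ.map a i (Φ x)
  isUnit_map a i x hx := Ψ.isUnit_map a i (Φ x) (by
    change Φ.symm (Φ x) ∈ V₁.baseSet i ∩ V₂.baseSet a
    rwa [Φ.symm_apply_apply])
  map_mul_coordChange a b i j x hx := by
    have h := Ψ.map_mul_coordChange a b i j (Φ x) (by
      change Φ.symm (Φ x) ∈ (V₁.baseSet i ∩ V₁.baseSet j) ∩ (V₂.baseSet a ∩ V₂.baseSet b)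
      rwa [Φ.symm_apply_apply])
    simpa only [transport_coordChange, Φ.symm_apply_apply] using h

/-- Reading back preserves holomorphy. [folklore] -/
theorem IsHolomorphic.ofTransport {Φ : E ≃L[ℂ] E'}
    {Ψ : CocycleIso (V₁.transport Φ) (V₂.transport Φ)} (h : Ψ.IsHolomorphic) :
    Ψ.ofTransport.IsHolomorphic := fun a i p q ↦ by
  have h' := mdifferentiableOn_iff_differentiableOn.1 (h a i p q)
  refine mdifferentiableOn_iff_differentiableOn.2 (h'.comp Φ.differentiableOn fun x hx ↦ ?_)
  change Φ.symm (Φ x) ∈ V₁.baseSet i ∩ V₂.baseSet a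
  rwa [Φ.symm_apply_apply]

end CocycleIso

/-- Analytic equivalence of the transported cocycles gives analytic equivalence. [folklore] -/
theorem AnalyticallyEquivalent.of_transport {V₁ : SmoothComplexVectorBundle ι E E r}
    {V₂ : SmoothComplexVectorBundle ι' E E r} {Φ : E ≃L[ℂ] E'}
    (h : AnalyticallyEquivalent (V₁.transport Φ) (V₂.transport Φ)) : AnalyticallyEquivalent V₁ V₂ :=
  let ⟨Ψ, hΨ⟩ := h; ⟨Ψ.ofTransport, hΨ.ofTransport⟩

end SmoothComplexVectorBundle

end Transport

/-! ### Grauert's theorem over `ℂ^ι` in all ranks -/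

section Affine

variable {ι : Type*} [Fintype ι] [DecidableEq ι] {κ κ' : Type*} {r : ℕ}

open Literature.Analysis.Complex

namespace SmoothComplexVectorBundle

/-- The transition cocycle of a holomorphic `GL_r(ℂ)`-cocycle on `ℂ^ι` (charted on itself), as a
holomorphic cocycle with values in the Banach algebra of `r × r` matrices (`L^∞`-operator norm)
in the sense of `Literature.Analysis.Complex.HolCocycle`. [cite: LeitererSCV4, Ch. II §1.7] -/
def toHolCocycle (V : SmoothComplexVectorBundle κ (ι → ℂ) (ι → ℂ) r) (hV : V.IsHolomorphic) :
    HolCocycle ι (Matrix (Fin r) (Fin r) ℂ) κ where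
  U := V.baseSet
  isOpen_U := V.isOpen_baseSet
  exists_mem := V.exists_mem_baseSet
  g := V.coordChange
  differentiableOn_g a b := differentiableOn_matrix_iff_entry.2 fun p q ↦
    mdifferentiableOn_iff_differentiableOn.1 (hV a b p q)
  g_self := V.coordChange_self
  g_comp := V.coordChange_comp

/-- **Every holomorphic vector bundle over `ℂ^ι` is holomorphically trivial (Grauert 1958;
Leiterer, SCV IV, Ch. II, Cor. 2.17 / Cor. 3.4).** A holomorphic `GL_r(ℂ)`-cocycle on `ℂ^ι`
(any rank `r`, any cover) is analytically equivalent to the trivial bundle: a global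
holomorphic frame `F_i = g_{ij} F_j` (`HolCocycle.exists_frame_univ`) gives the holomorphic
isomorphism `λ_i = F_i⁻¹` (`λ_i g_{ij} = λ_j`). (`r = 0`: all `0 × 0` matrices agree.)
[cite: LeitererSCV4, Ch. II Cor. 2.17] -/
theorem IsHolomorphic.analyticallyEquivalent_trivial_pi
    {V : SmoothComplexVectorBundle κ (ι → ℂ) (ι → ℂ) r} (hV : V.IsHolomorphic) :
    AnalyticallyEquivalent V (SmoothComplexVectorBundle.trivial (ι → ℂ) (ι → ℂ) r) := by
  rcases Nat.eq_zero_or_pos r with hr | hr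
  · subst hr
    refine ⟨{ map := fun _ _ _ ↦ 1
              isUnit_map := fun _ _ _ _ ↦ isUnit_one
              map_mul_coordChange := fun _ _ _ _ _ _ ↦ Subsingleton.elim _ _ }, ?_⟩
    exact fun _ _ p ↦ p.elim0
  haveI : NeZero r := ⟨hr.ne'⟩
  set 𝓖 := V.toHolCocycle hV with h𝓖
  obtain ⟨Φ⟩ := 𝓖.exists_frame_univ
  refine ⟨{ map := fun _ i x ↦ Φ.inv i x
            isUnit_map := fun _ i x hx ↦ Φ.isUnit_inv ⟨mem_univ x, hx.1⟩
            map_mul_coordChange := fun _ _ i j x hx ↦ ?_ }, ?_⟩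
  · change Φ.inv i x * 𝓖.g i j x = 1 * Φ.inv j x
    rw [one_mul, ← Φ.inv_eq_inv_mul_g ⟨⟨mem_univ x, hx.1.1⟩, hx.1.2⟩]
  · intro a i p q
    refine mdifferentiableOn_iff_differentiableOn.2 ?_
    have h := differentiableOn_matrix_iff_entry.1 (Φ.differentiableOn_inv i) p q
    exact h.mono fun x hx ↦ ⟨mem_univ x, hx.1⟩

/-- **Any two holomorphic cocycles of the same rank on `ℂ^ι` are analytically equivalent**
(both are analytically trivial). [cite: LeitererSCV4, Ch. II Cor. 2.17, Cor. 3.3 (i)] -/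
theorem analyticallyEquivalent_of_isHolomorphic_pi {V₁ : SmoothComplexVectorBundle κ (ι → ℂ) (ι → ℂ) r}
    {V₂ : SmoothComplexVectorBundle κ' (ι → ℂ) (ι → ℂ) r} (h₁ : V₁.IsHolomorphic)
    (h₂ : V₂.IsHolomorphic) : AnalyticallyEquivalent V₁ V₂ :=
  h₁.analyticallyEquivalent_trivial_pi.trans h₂.analyticallyEquivalent_trivial_pi.symm

/-- **Any two holomorphic cocycles of the same rank on a finite-dimensional complex vector space
`E`** (charted on itself) **are analytically equivalent** — transport along a complex-linear
`E ≃ ℂ^{dim E}`. [cite: LeitererSCV4, Ch. II Cor. 2.17, Cor. 3.3 (i)] -/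
theorem analyticallyEquivalent_of_isHolomorphic_self {ι₁ ι₂ : Type*} {E : Type*}
    [NormedAddCommGroup E] [NormedSpace ℂ E] [FiniteDimensional ℂ E]
    {V₁ : SmoothComplexVectorBundle ι₁ E E r} {V₂ : SmoothComplexVectorBundle ι₂ E E r}
    (h₁ : V₁.IsHolomorphic) (h₂ : V₂.IsHolomorphic) : AnalyticallyEquivalent V₁ V₂ := by
  have hd : Module.finrank ℂ E = Module.finrank ℂ (Fin (Module.finrank ℂ E) → ℂ) := by simp
  set Φ : E ≃L[ℂ] (Fin (Module.finrank ℂ E) → ℂ) := ContinuousLinearEquiv.ofFinrankEq hd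
  exact AnalyticallyEquivalent.of_transport
    (analyticallyEquivalent_of_isHolomorphic_pi (h₁.transport Φ) (h₂.transport Φ))

end SmoothComplexVectorBundle

open SmoothComplexVectorBundle

universe u w in
/-- **The case `M = E` of Grauert's Oka principle (uniqueness half), all ranks, proved** — in the
binder shape of the named fact `grauert_oka_analyticallyEquivalent` (Fritzsche–Grauert Ch. V
§1.5 (2)): for every finite-dimensional complex normed space `E` (a Stein manifold charted on
itself), all index types, every rank `r`, and holomorphic `GL_r(ℂ)`-cocycles `V₁`, `V₂` on `E`,
topological equivalence implies analytic equivalence. Here the conclusion holds outright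
(`analyticallyEquivalent_of_isHolomorphic_self`: over `E ≅ ℂⁿ` every holomorphic vector bundle
is analytically trivial — Grauert 1958, Leiterer Cor. 2.17/3.4), so the topological hypothesis
and the fact's further hypotheses on the base (`T2Space`, `SecondCountableTopology`,
`IsManifold 𝓘(ℂ, E) ω`, `IsSteinManifold E E`, all true for `E`) are not used. The general fact
(abstract Stein base) is NOT discharged by this. [cite: FritzscheGrauert2002, Ch. V §1.5 (Oka's principle) (2), case X = ℂⁿ] -/
theorem grauert_oka_analyticallyEquivalent_self (E : Type u) [NormedAddCommGroup E]
    [NormedSpace ℂ E] [FiniteDimensional ℂ E] (ι₁ ι₂ : Type w) (r : ℕ)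
    (V₁ : SmoothComplexVectorBundle ι₁ E E r) (V₂ : SmoothComplexVectorBundle ι₂ E E r) :
    V₁.IsHolomorphic → V₂.IsHolomorphic →
      TopologicallyEquivalent V₁ V₂ → AnalyticallyEquivalent V₁ V₂ :=
  fun h₁ h₂ _ ↦ analyticallyEquivalent_of_isHolomorphic_self h₁ h₂

end Affine

end Literature.Geometry.Kaehler

end
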